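import Literature.NumberTheory.Sieve.CFSemigroupConvergents
import HarnessLib

/-!
# The limit set of `Γ_A` lies over `[0, 1]` (support for `CFSemigroupCounting`)

`CFSemigroupCounting.lean` defines the limit set `cfLimitSet A` of the continued fractions
semigroup `Γ_A` [MageeOhWinter2019, §1] as the set of accumulation points IN `ℂ` of the orbit
`Γ_A · i`, remarking that "for `Γ_A` the orbit lies over `[0, 1]`, so it does not accumulate at
`∞`". This file PROVES that remark, certifying the faithfulness of the definition:

* `re_im_smul_I_of_mem_cfSemigroup`: for `γ = (a b; c e) ∈ Γ_A` one has
  `γ · i = ((ac + be) + i)/(c² + e²)` with `0 ≤ a ≤ c`, `0 ≤ b ≤ e`, `e ≥ 1`, so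
  `Re(γ · i) ∈ [0, 1]` and `Im(γ · i) = 1/(c² + e²) ∈ (0, 1]`;
* `finite_cfOrbit_im_gt`: only finitely many orbit points have imaginary part `> ε > 0`
  (the orbit of `i` under `SL₂(ℤ)` is discrete in `ℍ`);
* `cfLimitSet_subset_image_Icc`: `Λ(Γ_A) ⊆ [0, 1] ⊆ ℝ ⊆ ℂ` — the limit set is a bounded subset
  of the real line, as asserted in [MageeOhWinter2019, §1, §2.1 II] (`K ⊆ I_A ⊆ [0, 1]`);
* `cfDimension_le_one`: consequently `δ_A = dim_H Λ(Γ_A) ≤ 1`.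

All statements are proved (folklore).

## References

* M. Magee, H. Oh, D. Winter, J. reine angew. Math. 753 (2019) 89–135, §1, §2.1 II. [MageeOhWinter2019]
-/

noncomputable section

open Filter Set
open scoped Topology MatrixGroups

namespace Literature.NumberTheory.Sieve

/-! ### Entries of the elements of `Γ_A` -/

/-- A list is the map of its default-extended entry function over `range length`. [folklore] -/
theorem map_getD_range_eq (w : List ℕ) : (List.range w.length).map (fun i => w.getD i 1) = w := by
  refine List.ext_getElem (by simp) fun i h₁ h₂ => ?_
  simp only [List.getElem_map, List.getElem_range]
  exact List.getD_eq_getElem _ _ h₂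

/-- Every element of `Γ_A` is a word matrix `M_n(d)`, `n ≥ 1`, for a digit sequence with all
digits `≥ 1` (digits from `A ⊆ ℕ_{≥1}` inside the word, `1` beyond it). [folklore] -/
theorem exists_eq_cfWord_of_mem_cfSemigroup {A : Finset ℕ} (hA : ∀ a ∈ A, 1 ≤ a)
    {M : Matrix (Fin 2) (Fin 2) ℤ} (hM : M ∈ cfSemigroup A) :
    ∃ d : ℕ → ℕ, (∀ i, 1 ≤ d i) ∧ ∃ m : ℕ, M = cfWord d (m + 1) := by
  obtain ⟨w, hw, -, hwA, rfl⟩ := hM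
  obtain ⟨m, hm⟩ : ∃ m, w.length = m + 1 :=
    Nat.exists_eq_add_one.2 (List.length_pos_iff.2 hw)
  refine ⟨fun i => w.getD i 1, fun i => ?_, m, ?_⟩
  · show 1 ≤ w.getD i 1
    rw [List.getD_eq_getElem?_getD]
    cases h : w[i]? with
    | none => simp
    | some a => simpa using hA a (hwA a (List.mem_of_getElem? h))
  · rw [cfWord_eq_prod, ← hm, map_getD_range_eq]

/-- Entrywise bounds for `γ = (a b; c e) ∈ Γ_A`: `0 ≤ a ≤ c`, `0 ≤ b ≤ e`, `1 ≤ e`.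
[folklore] -/
theorem entries_of_mem_cfSemigroup {A : Finset ℕ} (hA : ∀ a ∈ A, 1 ≤ a)
    {M : Matrix (Fin 2) (Fin 2) ℤ} (hM : M ∈ cfSemigroup A) :
    (0 ≤ M 0 0 ∧ M 0 0 ≤ M 1 0) ∧ (0 ≤ M 0 1 ∧ M 0 1 ≤ M 1 1) ∧ 1 ≤ M 1 1 := by
  obtain ⟨d, hd, m, rfl⟩ := exists_eq_cfWord_of_mem_cfSemigroup hA hM
  exact ⟨⟨cfWord_nonneg d _ 0 0, (cfWord_fst_le_snd hd m).1⟩,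
    ⟨cfWord_nonneg d _ 0 1, cfNum_le_cfDen hd (m + 1)⟩, one_le_cfDen hd (m + 1)⟩

/-! ### The orbit points `γ · i` -/

/-- For a real matrix `(a b; c e)` with `ae - bc = 1` and `e > 0`:
`(a i + b)/(c i + e) = ((ac + be) + i)/(c² + e²)`. [folklore] -/
theorem moebius_I_eq {a b c e : ℝ} (hdet : a * e - b * c = 1) (he : 0 < e) :
    ((a : ℂ) * Complex.I + b) / ((c : ℂ) * Complex.I + e) =
      (((a * c + b * e : ℝ) : ℂ) + Complex.I) / ((c ^ 2 + e ^ 2 : ℝ) : ℂ) := by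
  obtain ⟨p, hp⟩ : ∃ p : ℝ, p = a * c + b * e := ⟨_, rfl⟩
  obtain ⟨q, hq⟩ : ∃ q : ℝ, q = c ^ 2 + e ^ 2 := ⟨_, rfl⟩
  rw [← hp, ← hq]
  have hden : (c : ℂ) * Complex.I + e ≠ 0 := by
    intro h
    have := congrArg Complex.re h
    simp at this
    linarith
  have hq0 : (0 : ℝ) < q := by rw [hq]; positivity
  have hden' : (q : ℂ) ≠ 0 := by exact_mod_cast hq0.ne'
  rw [div_eq_div_iff hden hden']
  apply Complex.ext
  · simp
    rw [hp, hq]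
    linear_combination (-c) * hdet
  · simp
    rw [hp, hq]
    linear_combination e * hdet

/-- The orbit of `i` under `Γ_A`, as a subset of `ℂ` (the set whose derived set is
`cfLimitSet A`). [cite: MageeOhWinter2019, §1] -/
def cfOrbit (A : Finset ℕ) : Set ℂ :=
  {z : ℂ | ∃ γ : SL(2, ℤ), (γ : Matrix (Fin 2) (Fin 2) ℤ) ∈ cfSemigroup A ∧
    z = ((γ • UpperHalfPlane.I : UpperHalfPlane) : ℂ)}

/-- `cfLimitSet A` is the derived set of `cfOrbit A` (definitional). [cite: MageeOhWinter2019, §1] -/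
theorem cfLimitSet_eq_derivedSet (A : Finset ℕ) : cfLimitSet A = derivedSet (cfOrbit A) := rfl

/-- **Orbit points lie over `[0, 1]`.** For `γ = (a b; c e) ∈ Γ_A` (`A ⊆ ℕ_{≥1}`):
`Re(γ · i) ∈ [0, 1]`, `Im(γ · i) = 1/(c² + e²)`, and `c, e ∈ [0, c² + e²]`-type bounds:
precisely `0 ≤ Re ≤ 1`, `Im = 1/(c² + e²)` with `1 ≤ c² + e²`. [cite: MageeOhWinter2019, §2.1 II] -/
theorem re_im_smul_I_of_mem_cfSemigroup {A : Finset ℕ} (hA : ∀ a ∈ A, 1 ≤ a) (γ : SL(2, ℤ))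
    (hγ : (γ : Matrix (Fin 2) (Fin 2) ℤ) ∈ cfSemigroup A) :
    ((γ • UpperHalfPlane.I : UpperHalfPlane) : ℂ).re ∈ Icc (0 : ℝ) 1 ∧
      ((γ • UpperHalfPlane.I : UpperHalfPlane) : ℂ).im =
        1 / (((γ : Matrix (Fin 2) (Fin 2) ℤ) 1 0 : ℝ) ^ 2 + ((γ : Matrix (Fin 2) (Fin 2) ℤ) 1 1 : ℝ) ^ 2) := by
  obtain ⟨⟨ha0, hac⟩, ⟨hb0, hbe⟩, he1⟩ := entries_of_mem_cfSemigroup hA hγ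
  set M : Matrix (Fin 2) (Fin 2) ℤ := (γ : Matrix (Fin 2) (Fin 2) ℤ) with hM
  have hdetZ : M 0 0 * M 1 1 - M 0 1 * M 1 0 = 1 := by
    rw [← Matrix.det_fin_two]; exact γ.prop
  have hdet : (M 0 0 : ℝ) * M 1 1 - M 0 1 * M 1 0 = 1 := by exact_mod_cast hdetZ
  have ha : (0 : ℝ) ≤ M 0 0 := by exact_mod_cast ha0
  have hb : (0 : ℝ) ≤ M 0 1 := by exact_mod_cast hb0
  have hac' : (M 0 0 : ℝ) ≤ M 1 0 := by exact_mod_cast hac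
  have hbe' : (M 0 1 : ℝ) ≤ M 1 1 := by exact_mod_cast hbe
  have he : (1 : ℝ) ≤ M 1 1 := by exact_mod_cast he1
  have hcoe : ((γ • UpperHalfPlane.I : UpperHalfPlane) : ℂ) =
      (((M 0 0 : ℝ) : ℂ) * Complex.I + ((M 0 1 : ℝ) : ℂ)) /
        (((M 1 0 : ℝ) : ℂ) * Complex.I + ((M 1 1 : ℝ) : ℂ)) := by
    rw [UpperHalfPlane.coe_specialLinearGroup_apply]
    simp [hM, UpperHalfPlane.coe_I]
  have hq : (1 : ℝ) ≤ (M 1 0 : ℝ) ^ 2 + (M 1 1 : ℝ) ^ 2 := by nlinarith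
  have hq0 : (0 : ℝ) < (M 1 0 : ℝ) ^ 2 + (M 1 1 : ℝ) ^ 2 := by linarith
  rw [hcoe, moebius_I_eq hdet (by linarith), Complex.div_ofReal_re, Complex.div_ofReal_im]
  simp only [Complex.add_re, Complex.ofReal_re, Complex.I_re, add_zero, Complex.add_im,
    Complex.ofReal_im, Complex.I_im, zero_add]
  refine ⟨⟨div_nonneg (add_nonneg (mul_nonneg ha (ha.trans hac')) (mul_nonneg hb (hb.trans hbe')))
    hq0.le, ?_⟩, trivial⟩
  rw [div_le_one hq0]
  nlinarith

/-- The orbit lies in the box `[0, 1] × (0, 1]`; in particular in the closed unit square.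
[folklore] -/
theorem cfOrbit_subset_box {A : Finset ℕ} (hA : ∀ a ∈ A, 1 ≤ a) :
    cfOrbit A ⊆ {z : ℂ | z.re ∈ Icc (0 : ℝ) 1 ∧ z.im ∈ Icc (0 : ℝ) 1} := by
  rintro _ ⟨γ, hγ, rfl⟩
  obtain ⟨hre, him⟩ := re_im_smul_I_of_mem_cfSemigroup hA γ hγ
  obtain ⟨-, -, he1⟩ := entries_of_mem_cfSemigroup hA hγ
  have he : (1 : ℝ) ≤ ((γ : Matrix (Fin 2) (Fin 2) ℤ) 1 1 : ℝ) := by exact_mod_cast he1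
  have hq : (1 : ℝ) ≤ ((γ : Matrix (Fin 2) (Fin 2) ℤ) 1 0 : ℝ) ^ 2 +
      ((γ : Matrix (Fin 2) (Fin 2) ℤ) 1 1 : ℝ) ^ 2 := by nlinarith
  refine ⟨hre, ?_, ?_⟩
  · rw [him]; positivity
  · rw [him, div_le_one (by linarith)]; exact hq

/-- **Discreteness.** Only finitely many orbit points have imaginary part `> ε` (`ε > 0`):
`Im(γ · i) = 1/(c² + e²) > ε` bounds `c, e`, hence (by `a ≤ c`, `b ≤ e`) all four entries of
`γ`. [folklore] -/
theorem finite_cfOrbit_im_gt {A : Finset ℕ} (hA : ∀ a ∈ A, 1 ≤ a) {ε : ℝ} (hε : 0 < ε) :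
    {z ∈ cfOrbit A | ε < z.im}.Finite := by
  -- all entries of the relevant `γ` lie in `[0, N]`
  obtain ⟨N, hN⟩ : ∃ N : ℕ, 1 / ε < N := exists_nat_gt _
  let f : Matrix (Fin 2) (Fin 2) ℤ → ℂ := fun M =>
    (((M 0 0 : ℝ) : ℂ) * Complex.I + ((M 0 1 : ℝ) : ℂ)) /
      (((M 1 0 : ℝ) : ℂ) * Complex.I + ((M 1 1 : ℝ) : ℂ))
  let g : (Fin 2 → Fin 2 → Fin (N + 1)) → Matrix (Fin 2) (Fin 2) ℤ := fun v =>
    Matrix.of fun i j => ((v i j : ℕ) : ℤ)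
  refine (Set.finite_range (f ∘ g)).subset ?_
  rintro z ⟨⟨γ, hγ, rfl⟩, hz⟩
  obtain ⟨⟨ha0, hac⟩, ⟨hb0, hbe⟩, he1⟩ := entries_of_mem_cfSemigroup hA hγ
  obtain ⟨-, him⟩ := re_im_smul_I_of_mem_cfSemigroup hA γ hγ
  have hz' := hz.trans_eq him
  -- the bound `c² + e² < 1/ε < N`
  have hq0 : (0 : ℝ) < ((γ : Matrix (Fin 2) (Fin 2) ℤ) 1 0 : ℝ) ^ 2 +
      ((γ : Matrix (Fin 2) (Fin 2) ℤ) 1 1 : ℝ) ^ 2 := by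
    have he : (1 : ℝ) ≤ (γ : Matrix (Fin 2) (Fin 2) ℤ) 1 1 := by exact_mod_cast he1
    nlinarith
  have hqN : (γ : Matrix (Fin 2) (Fin 2) ℤ) 1 0 ^ 2 + (γ : Matrix (Fin 2) (Fin 2) ℤ) 1 1 ^ 2 < N := by
    have h1 : ((γ : Matrix (Fin 2) (Fin 2) ℤ) 1 0 : ℝ) ^ 2 +
        ((γ : Matrix (Fin 2) (Fin 2) ℤ) 1 1 : ℝ) ^ 2 < 1 / ε := by
      rw [lt_one_div hq0 hε]
      exact hz'
    exact_mod_cast h1.trans hN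
  have hc0 : (0 : ℤ) ≤ (γ : Matrix (Fin 2) (Fin 2) ℤ) 1 0 := ha0.trans hac
  have hcN : (γ : Matrix (Fin 2) (Fin 2) ℤ) 1 0 ≤ N := by
    nlinarith [Int.le_self_sq ((γ : Matrix (Fin 2) (Fin 2) ℤ) 1 0),
      sq_nonneg ((γ : Matrix (Fin 2) (Fin 2) ℤ) 1 1)]
  have heN : (γ : Matrix (Fin 2) (Fin 2) ℤ) 1 1 ≤ N := by
    nlinarith [Int.le_self_sq ((γ : Matrix (Fin 2) (Fin 2) ℤ) 1 1),
      sq_nonneg ((γ : Matrix (Fin 2) (Fin 2) ℤ) 1 0)]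
  have hbound : ∀ i j, 0 ≤ (γ : Matrix (Fin 2) (Fin 2) ℤ) i j ∧
      (γ : Matrix (Fin 2) (Fin 2) ℤ) i j ≤ N := by
    intro i j
    fin_cases i <;> fin_cases j
    · exact ⟨ha0, hac.trans hcN⟩
    · exact ⟨hb0, hbe.trans heN⟩
    · exact ⟨hc0, hcN⟩
    · exact ⟨zero_le_one.trans he1, heN⟩
  have hlt : ∀ i j, ((γ : Matrix (Fin 2) (Fin 2) ℤ) i j).toNat < N + 1 := by
    intro i j
    have h := (hbound i j).2
    have h0 := (hbound i j).1
    zify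
    rw [Int.toNat_of_nonneg h0]
    omega
  -- the preimage in `Fin 2 → Fin 2 → Fin (N+1)`
  refine ⟨fun i j => ⟨((γ : Matrix (Fin 2) (Fin 2) ℤ) i j).toNat, hlt i j⟩, ?_⟩
  have hg : g (fun i j => ⟨((γ : Matrix (Fin 2) (Fin 2) ℤ) i j).toNat, hlt i j⟩) =
      (γ : Matrix (Fin 2) (Fin 2) ℤ) := by
    ext i j
    simp only [g, Matrix.of_apply]
    rw [Int.natCast_toNat_eq_self]
    exact (hbound i j).1
  simp only [Function.comp_apply, hg]
  rw [UpperHalfPlane.coe_specialLinearGroup_apply]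
  simp [f, UpperHalfPlane.coe_I]

/-- **`Λ(Γ_A) ⊆ [0, 1] ⊆ ℝ`.** The limit set of `Γ_A` (accumulation points in `ℂ` of the orbit
`Γ_A · i`) is contained in the real segment `[0, 1]`: the orbit lies in the box
`[0,1] × (0,1]` and is discrete in the open upper half plane. In particular no accumulation is
lost by working in `ℂ` rather than `ℂ ∪ {∞}`. [cite: MageeOhWinter2019, §1 and §2.1 II] -/
theorem cfLimitSet_subset_image_Icc {A : Finset ℕ} (hA : ∀ a ∈ A, 1 ≤ a) :
    cfLimitSet A ⊆ (fun x : ℝ => (x : ℂ)) '' Icc (0 : ℝ) 1 := by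
  intro z hz
  rw [cfLimitSet_eq_derivedSet] at hz
  -- `z` lies in the closed unit square
  have hbox : z ∈ {z : ℂ | z.re ∈ Icc (0 : ℝ) 1 ∧ z.im ∈ Icc (0 : ℝ) 1} := by
    have hcl : IsClosed {z : ℂ | z.re ∈ Icc (0 : ℝ) 1 ∧ z.im ∈ Icc (0 : ℝ) 1} :=
      (isClosed_Icc.preimage Complex.continuous_re).inter
        (isClosed_Icc.preimage Complex.continuous_im)
    exact (hcl.closure_subset_iff.2 (cfOrbit_subset_box hA)) (derivedSet_subset_closure _ hz)
  -- and its imaginary part vanishes: no accumulation inside `ℍ`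
  have him : z.im = 0 := by
    by_contra hne
    have hpos : 0 < z.im := lt_of_le_of_ne hbox.2.1 (Ne.symm hne)
    set ε : ℝ := z.im / 2 with hε
    have hε0 : 0 < ε := by positivity
    have hfin := finite_cfOrbit_im_gt hA hε0
    set F : Set ℂ := {w ∈ cfOrbit A | ε < w.im} \ {z} with hF
    have hFc : IsClosed F := (hfin.subset fun x hx => hx.1).isClosed
    have hU : {w : ℂ | ε < w.im} ∩ Fᶜ ∈ 𝓝 z := by
      refine Filter.inter_mem ?_ (hFc.isOpen_compl.mem_nhds fun h => h.2 rfl)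
      exact (isOpen_lt continuous_const Complex.continuous_im).mem_nhds (by
        show ε < z.im
        rw [hε]; linarith)
    obtain ⟨y, ⟨⟨hyε, hyF⟩, hyO⟩, hyz⟩ := accPt_iff_nhds.1 hz _ hU
    exact hyF ⟨⟨hyO, hyε⟩, hyz⟩
  refine ⟨z.re, hbox.1, ?_⟩
  apply Complex.ext <;> simp [him]

/-- **`δ_A ≤ 1`**: the limit set of `Γ_A` is a subset of a real segment, so its Hausdorff
dimension is at most `1`. [cite: MageeOhWinter2019, §1] -/
theorem cfDimension_le_one {A : Finset ℕ} (hA : ∀ a ∈ A, 1 ≤ a) : cfDimension A ≤ 1 := by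
  have h1 : dimH (cfLimitSet A) ≤ 1 :=
    calc dimH (cfLimitSet A) ≤ dimH ((fun x : ℝ => (x : ℂ)) '' Icc (0 : ℝ) 1) :=
          dimH_mono (cfLimitSet_subset_image_Icc hA)
      _ = dimH (Icc (0 : ℝ) 1) := Complex.isometry_ofReal.dimH_image _
      _ ≤ dimH (univ : Set ℝ) := dimH_mono (subset_univ _)
      _ = 1 := Real.dimH_univ
  have h2 := ENNReal.toReal_mono ENNReal.one_ne_top h1
  simpa [cfDimension] using h2

end Literature.NumberTheory.Sieve
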